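import Mathlib
import Literature.NumberTheory.LFunctions.Zhang2022.Section17U025WeightDefect
import Literature.NumberTheory.LFunctions.Zhang2022.Section17InnerEdges
import Literature.NumberTheory.LFunctions.Zhang2022.Section3Lemma34
import Literature.NumberTheory.LFunctions.Zhang2022.Section10Theta1Evals
import HarnessLib

/-!
# Zhang (2022) §17 p. 98: the first equality of `Z22:§17.u025` (hypothesis `hW`) — pointwise layer

Topic `Literature/NumberTheory/LFunctions/Zhang2022` (Landau–Siegel audit tree; verdict-neutral).
Y. Zhang, *Discrete mean estimates and the Landau–Siegel zero*, arXiv:2211.02515v1 (2022)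
[Zhang2022LandauSiegel] — **an unrefereed manuscript under adjudication; nothing here asserts or denies
its Theorems 1–2.** Lane ZHANG-L, WP16, helper under the leaf `Typed.Section17.Eq17_9Rel` (owner
zl-w16-p3): the node "`𝔢₁Σ_{l<D⁴}(ν(l)/l)Σ_{l=l₁l₂}χ(l₁)τ₂(l₁)ν₁*(l₂) = 𝔢₁Σ_{l<D⁴}ν(l)²/l + o(1)`"
(§17 p. 98, tex L4841; hypothesis `hW` of `Phi3Eval.step17_u025_of`).

Continuing `Section17U025WeightDefect` (the exact defect identity `E(l) = ((χ∗μ)∗(W − τ₂))(l)`,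
`W = nN_{β₂} ∗ nN_{β₃}`), this file proves the POINTWISE expansion of the defect and its divisor-type
majorant, generically in the two weights:

* `norm_mul_sub_one_sub_le` — for complex `w₂, w₃` with `wⱼ = 1 + xⱼ + rⱼ`:
  `‖w₂w₃ − 1 − (x₂ + x₃)‖ ≤ ‖r₂‖ + ‖r₃‖ + ‖w₂ − 1‖‖w₃ − 1‖`;
* `norm_cexp_mul_sub_one_sub_le` — `‖e^{x}g − 1 − x‖ ≤ ‖x‖² + η` for `Re x = 0`, `‖x‖ ≤ 1`, real `g` with
  `|g − 1| ≤ η` (so `nN_β(m) = 1 − β log m + O(|β|²log²m + e^{−𝓛³⁰log²(T²/m)})`, `nN_expansion`);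
* `norm_convolution_le_tau_add` — the divisor-majorant product rule for `LSeries.convolution`
  (`MeanSquareMajorant.norm_seqConv_le_tau`);
* `norm_defectSum_sub_linear_le` — for `W(m) − τ₂(m) = Σ_{m=m₂m₃}(w₂(m₂)w₃(m₃) − 1)`: removing the
  linear part `Σ_{m=m₂m₃}(x₂(m₂) + x₃(m₃))` costs `≤ (2ρ₂ + ρ₁²)·τ₂(m)` when `‖wⱼ − 1‖ ≤ ρ₁`,
  `‖wⱼ − 1 − xⱼ‖ ≤ ρ₂` on the divisors;
* `sum_divisorsAntidiagonal_log_add` — `Σ_{m=m₂m₃}(β₂log m₂ + β₃log m₃) = (β₂+β₃)Σ_{d∣m} log d`;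
* `chi_mul_moebius_mul_logZeta` — `((χ∗μ)∗(log∗1))(l) = Σ_{d∣l}χ(l/d)log d` (`μ∗1 = δ`), with
  `‖·‖ ≤ τ₂(l)·log l`;
* `norm_sum_div_mul_le_sqrt_mul_sqrt` — Cauchy–Schwarz in the form `Σ a(l)b(l)/l ≤ √(Σa²/l)·√(Σb²/l)`.

The ν-weighted summation over `l < D⁴` against Lemma 17.1 (`Skeleton.appBLemma171_holds`) and
`𝔞 ≤ 16e⁹𝓛⁴` (`Skeleton.frakA_le_ell_pow_four'`) — the `o(1)` itself — is the companion step
(same lane), consuming exactly these lemmas.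

## References

* Y. Zhang, arXiv:2211.02515v1 (2022), §17 p. 98 (tex L4841); §17 p. 96 (u007, the weight
  replacements); §4 (4.2). [cite: Zhang2022LandauSiegel, §17 u025 p.98]
-/

noncomputable section

open Complex Real ComplexConjugate ArithmeticFunction Finset

namespace Literature.NumberTheory.LFunctions.Zhang2022.Typed.Section17

open Literature.NumberTheory.LFunctions.Zhang2022
open Literature.NumberTheory.LFunctions.Zhang2022.Skeleton
open Literature.NumberTheory.LFunctions.Zhang2022.MeanSquareMajorant (tau)

/-! ## §1 Pure inequalities -/

section Pure

/-- `w₂w₃ − 1 − (x₂ + x₃) = r₂ + r₃ + (w₂−1)(w₃−1)` with `rⱼ = wⱼ − 1 − xⱼ`, in norm.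
[cite: Zhang2022LandauSiegel, §17 u025 p.98] -/
theorem norm_mul_sub_one_sub_le (w₂ w₃ x₂ x₃ : ℂ) :
    ‖w₂ * w₃ - 1 - (x₂ + x₃)‖ ≤ ‖w₂ - 1 - x₂‖ + ‖w₃ - 1 - x₃‖ + ‖w₂ - 1‖ * ‖w₃ - 1‖ := by
  have e : w₂ * w₃ - 1 - (x₂ + x₃) = (w₂ - 1 - x₂) + (w₃ - 1 - x₃) + (w₂ - 1) * (w₃ - 1) := by ring
  rw [e]
  refine (norm_add_le _ _).trans (add_le_add ((norm_add_le _ _).trans le_rfl) ?_)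
  rw [norm_mul]

/-- For `x` purely imaginary with `‖x‖ ≤ 1` and a real `g` with `|g − 1| ≤ η`:
`‖eˣ·g − 1 − x‖ ≤ ‖x‖² + η` (`eˣ = 1 + x + O(‖x‖²)`, `‖eˣ‖ = 1`). [cite: Zhang2022LandauSiegel, §17 u007 p.96] -/
theorem norm_cexp_mul_sub_one_sub_le {x : ℂ} (hx : x.re = 0) (hx1 : ‖x‖ ≤ 1) {g η : ℝ}
    (hg : |g - 1| ≤ η) : ‖Complex.exp x * (g : ℂ) - 1 - x‖ ≤ ‖x‖ ^ 2 + η := by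
  have e : Complex.exp x * (g : ℂ) - 1 - x =
      (Complex.exp x - 1 - x) + Complex.exp x * ((g : ℂ) - 1) := by ring
  have hexp : ‖Complex.exp x‖ = 1 := by rw [Complex.norm_exp, hx, Real.exp_zero]
  rw [e]
  refine (norm_add_le _ _).trans (add_le_add (Complex.norm_exp_sub_one_sub_id_le hx1) ?_)
  rw [norm_mul, hexp, one_mul, ← Complex.ofReal_one, ← Complex.ofReal_sub, Complex.norm_real,
    Real.norm_eq_abs]
  exact hg

/-- **Cauchy–Schwarz with the weight `1/l`**: for nonnegative `a, b` on a finite set of positive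
integers, `Σ a(l)b(l)/l ≤ √(Σ a(l)²/l)·√(Σ b(l)²/l)`. [cite: Zhang2022LandauSiegel, §17 u025 p.98] -/
theorem norm_sum_div_mul_le_sqrt_mul_sqrt (S : Finset ℕ) (a b : ℕ → ℝ) :
    ∑ l ∈ S, a l * b l / (l : ℝ) ≤
      Real.sqrt (∑ l ∈ S, a l ^ 2 / (l : ℝ)) * Real.sqrt (∑ l ∈ S, b l ^ 2 / (l : ℝ)) := by
  have h := Real.sum_mul_le_sqrt_mul_sqrt S (fun l => a l / Real.sqrt l) (fun l => b l / Real.sqrt l)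
  have e1 : ∀ l : ℕ, a l / Real.sqrt l * (b l / Real.sqrt l) = a l * b l / (l : ℝ) := by
    intro l
    rw [div_mul_div_comm, Real.mul_self_sqrt (Nat.cast_nonneg l)]
  have e2 : ∀ (c : ℕ → ℝ) (l : ℕ), (c l / Real.sqrt l) ^ 2 = c l ^ 2 / (l : ℝ) := by
    intro c l
    rw [div_pow, Real.sq_sqrt (Nat.cast_nonneg l)]
  simp only [e1, e2] at h
  exact h

end Pure

/-! ## §2 The weights and the defect `W − τ₂` pointwise -/

section Defect

variable (c' : ℝ) {D : ℕ} (χ : DirichletCharacter ℂ D)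

/-- **Expansion of the weight**: for `Re β = 0`, `1 ≤ m ≤ T²`, `‖β‖·log m ≤ 1`:
`nN_β(m) = 1 − β·log m + r` with `‖r‖ ≤ ‖β‖²log²m + ½exp(−𝓛³⁰log²(T²/m))` (`𝓛 > 0`).
[cite: Zhang2022LandauSiegel, §17 u007 p.96; §4 (4.2)] -/
theorem nN_expansion (hℓ : 0 < ell D) {β : ℂ} (hβ : β.re = 0) {m : ℕ} (hm : 1 ≤ m)
    (hmT : (m : ℝ) ≤ bigT D ^ 2) (hsmall : ‖β‖ * Real.log m ≤ 1) :
    ‖nN D β m - 1 - (-(β * (Real.log m : ℂ)))‖ ≤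
      (‖β‖ * Real.log m) ^ 2 + 1 / 2 * Real.exp (-(ell D ^ 30) * Real.log (bigT D ^ 2 / m) ^ 2) := by
  have hm0 : (0 : ℝ) < m := by exact_mod_cast hm
  have hmc : (m : ℂ) ≠ 0 := by exact_mod_cast hm0.ne'
  set x : ℂ := -(β * (Real.log m : ℂ)) with hxdef
  have hxre : x.re = 0 := by
    rw [hxdef, Complex.neg_re, Complex.mul_re, Complex.ofReal_re, Complex.ofReal_im, hβ]
    ring
  have hxn : ‖x‖ = ‖β‖ * Real.log m := by
    rw [hxdef, norm_neg, norm_mul, Complex.norm_real, Real.norm_eq_abs,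
      abs_of_nonneg (Real.log_natCast_nonneg m)]
  have hcpow : (m : ℂ) ^ (-β) = Complex.exp x := by
    rw [Complex.cpow_def_of_ne_zero hmc, ← Complex.natCast_log, hxdef]
    congr 1; ring
  have hT : 1 ≤ bigT D ^ 2 / m := by rwa [le_div_iff₀ hm0, one_mul]
  have hT' : 1 / 2 < bigT D ^ 2 / m := lt_of_lt_of_le (by norm_num) hT
  have hg : |gW D (bigT D ^ 2 / m) - 1| ≤ 1 / 2 * Real.exp (-(ell D ^ 30) * Real.log (bigT D ^ 2 / m) ^ 2) := by
    rw [gW]; exact GaussWeight.abs_gWeight_sub_one_le (pow_pos hℓ 30) hT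
  have hnN : nN D β m = Complex.exp x * (gW D (bigT D ^ 2 / m) : ℂ) := by
    rw [nN, gstar, if_pos hT', hcpow]
  rw [hnN, ← hxn]
  exact norm_cexp_mul_sub_one_sub_le hxre (hxn ▸ hsmall) hg

/-- **Divisor majorants multiply under `LSeries.convolution`** (`MeanSquareMajorant.norm_seqConv_le_tau`
restated for Mathlib's convolution). [cite: Zhang2022LandauSiegel, §15 (15.2) p.79] -/
theorem norm_convolution_le_tau_add {u v : ℕ → ℂ} {C₁ C₂ : ℝ} {j₁ j₂ : ℕ} (hC₁ : 0 ≤ C₁)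
    (hu : ∀ n, n ≠ 0 → ‖u n‖ ≤ C₁ * tau j₁ n) (hv : ∀ n, n ≠ 0 → ‖v n‖ ≤ C₂ * tau j₂ n) (n : ℕ) :
    ‖LSeries.convolution u v n‖ ≤ C₁ * C₂ * tau (j₁ + j₂) n := by
  rw [LSeries.convolution_def]
  exact MeanSquareMajorant.norm_seqConv_le_tau hC₁ hu hv n

/-- **Removing the linear part of the defect**: if on the divisors of `m` the weights satisfy
`‖wⱼ(n) − 1‖ ≤ ρ₁` and `‖wⱼ(n) − 1 − xⱼ(n)‖ ≤ ρ₂` (`ρ₁ ≥ 0`), then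
`‖Σ_{m=m₂m₃}(w₂(m₂)w₃(m₃) − 1) − Σ_{m=m₂m₃}(x₂(m₂) + x₃(m₃))‖ ≤ (2ρ₂ + ρ₁²)·τ₂(m)`.
[cite: Zhang2022LandauSiegel, §17 u025 p.98] -/
theorem norm_defectSum_sub_linear_le (w₂ w₃ x₂ x₃ : ℕ → ℂ) {ρ₁ ρ₂ : ℝ} (hρ₁ : 0 ≤ ρ₁) {m : ℕ}
    (h1 : ∀ n, n ∣ m → ‖w₂ n - 1‖ ≤ ρ₁ ∧ ‖w₃ n - 1‖ ≤ ρ₁)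
    (h2 : ∀ n, n ∣ m → ‖w₂ n - 1 - x₂ n‖ ≤ ρ₂ ∧ ‖w₃ n - 1 - x₃ n‖ ≤ ρ₂) :
    ‖(∑ q ∈ m.divisorsAntidiagonal, (w₂ q.1 * w₃ q.2 - 1)) -
        ∑ q ∈ m.divisorsAntidiagonal, (x₂ q.1 + x₃ q.2)‖ ≤ (2 * ρ₂ + ρ₁ ^ 2) * tau 2 m := by
  rw [← Finset.sum_sub_distrib]
  have hcard : ((m.divisorsAntidiagonal.card : ℕ) : ℝ) = tau 2 m := by
    rw [MeanSquareMajorant.tau_two_apply, ← Nat.map_div_right_divisors, Finset.card_map]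
  refine (norm_sum_le _ _).trans ?_
  calc ∑ q ∈ m.divisorsAntidiagonal, ‖w₂ q.1 * w₃ q.2 - 1 - (x₂ q.1 + x₃ q.2)‖
      ≤ ∑ q ∈ m.divisorsAntidiagonal, (2 * ρ₂ + ρ₁ ^ 2) := by
        refine Finset.sum_le_sum fun q hq => ?_
        obtain ⟨hqm, -⟩ := Nat.mem_divisorsAntidiagonal.mp hq
        have hd1 : q.1 ∣ m := ⟨q.2, hqm.symm⟩
        have hd2 : q.2 ∣ m := ⟨q.1, by rw [mul_comm]; exact hqm.symm⟩
        calc ‖w₂ q.1 * w₃ q.2 - 1 - (x₂ q.1 + x₃ q.2)‖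
            ≤ ‖w₂ q.1 - 1 - x₂ q.1‖ + ‖w₃ q.2 - 1 - x₃ q.2‖ + ‖w₂ q.1 - 1‖ * ‖w₃ q.2 - 1‖ :=
              norm_mul_sub_one_sub_le _ _ _ _
          _ ≤ ρ₂ + ρ₂ + ρ₁ * ρ₁ := by
              refine add_le_add (add_le_add (h2 _ hd1).1 (h2 _ hd2).2) ?_
              exact mul_le_mul (h1 _ hd1).1 (h1 _ hd2).2 (norm_nonneg _) hρ₁
          _ = 2 * ρ₂ + ρ₁ ^ 2 := by ring
    _ = (2 * ρ₂ + ρ₁ ^ 2) * tau 2 m := by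
        rw [Finset.sum_const, nsmul_eq_mul, hcard, mul_comm]

/-- `Σ_{m=m₂m₃}(β₂·log m₂ + β₃·log m₃) = (β₂+β₃)·Σ_{d∣m} log d` (the two half-sums coincide by
`(m₂,m₃) ↦ (m₃,m₂)`). [cite: Zhang2022LandauSiegel, §17 u025 p.98] -/
theorem sum_divisorsAntidiagonal_log_add (β₂ β₃ : ℂ) (m : ℕ) :
    ∑ q ∈ m.divisorsAntidiagonal, (β₂ * (Real.log q.1 : ℂ) + β₃ * (Real.log q.2 : ℂ)) =
      (β₂ + β₃) * ∑ d ∈ m.divisors, (Real.log d : ℂ) := by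
  rw [Finset.sum_add_distrib, ← Finset.mul_sum, ← Finset.mul_sum,
    Nat.sum_divisorsAntidiagonal (f := fun a _ => (Real.log a : ℂ)),
    Nat.sum_divisorsAntidiagonal' (f := fun _ b => (Real.log b : ℂ)), add_mul]

/-- **`(χ∗μ)∗(log∗1) = χ∗log`** (`μ∗1 = δ`): for `l ≥ 1`,
`((χ∗μ) ∗ (m ↦ Σ_{d∣m} log d))(l) = Σ_{d∣l} χ(l/d)·log d`. [cite: Zhang2022LandauSiegel, §17 u025 p.98] -/
theorem chi_mul_moebius_mul_logZeta {l : ℕ} (hl : l ≠ 0) :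
    LSeries.convolution
        (LSeries.convolution (fun k => χ (k : ZMod D)) (fun k => (ArithmeticFunction.moebius k : ℂ)))
        (fun m => ∑ d ∈ m.divisors, (Real.log d : ℂ)) l =
      ∑ d ∈ l.divisors, χ ((l / d : ℕ) : ZMod D) * (Real.log d : ℂ) := by
  set Z : ArithmeticFunction ℂ := toArithmeticFunction (fun _ : ℕ => (1 : ℂ)) with hZ
  set M : ArithmeticFunction ℂ :=
    toArithmeticFunction (fun k : ℕ => (ArithmeticFunction.moebius k : ℂ)) with hM
  set X : ArithmeticFunction ℂ := toArithmeticFunction (fun k : ℕ => χ (k : ZMod D)) with hX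
  set Lg : ArithmeticFunction ℂ := toArithmeticFunction (fun k : ℕ => (Real.log k : ℂ)) with hLg
  have hZ1 : Z = (ArithmeticFunction.zeta : ArithmeticFunction ℂ) := by
    ext n
    by_cases h : n = 0
    · simp [hZ, toArithmeticFunction, h]
    · simp [hZ, toArithmeticFunction, h, ArithmeticFunction.natCoe_apply, ArithmeticFunction.zeta_apply]
  have hM1 : M = (ArithmeticFunction.moebius : ArithmeticFunction ℂ) := by
    ext n
    by_cases h : n = 0
    · simp [hM, toArithmeticFunction, h]
    · simp [hM, toArithmeticFunction, h, ArithmeticFunction.intCoe_apply]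
  have hMZ : M * Z = 1 := by
    rw [hZ1, hM1, mul_comm]; exact ArithmeticFunction.coe_zeta_mul_coe_moebius
  -- the divisor sum of `log` as `Lg * ζ`
  have hLZ : toArithmeticFunction (fun m : ℕ => ∑ d ∈ m.divisors, (Real.log d : ℂ)) = Lg * Z := by
    ext m
    rw [hZ1, ArithmeticFunction.coe_mul_zeta_apply]
    by_cases hm : m = 0
    · simp [toArithmeticFunction, hm]
    · simp only [toArithmeticFunction, ArithmeticFunction.coe_mk, hm, if_false]
      refine Finset.sum_congr rfl fun d hd => ?_
      have hd0 : d ≠ 0 := (Nat.pos_of_mem_divisors hd).ne'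
      simp [hLg, toArithmeticFunction, hd0]
  have lhs : LSeries.convolution
      (LSeries.convolution (fun k => χ (k : ZMod D)) (fun k => (ArithmeticFunction.moebius k : ℂ)))
      (fun m => ∑ d ∈ m.divisors, (Real.log d : ℂ)) l = ((X * M) * (Lg * Z)) l := by
    rw [← hLZ]
    simp only [LSeries.convolution, ArithmeticFunction.toArithmeticFunction_eq_self, hX, hM]
  have hring : (X * M) * (Lg * Z) = Lg * X := by
    calc (X * M) * (Lg * Z) = X * (M * Z) * Lg := by ring
      _ = Lg * X := by rw [hMZ, mul_one, mul_comm]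
  rw [lhs, hring, ArithmeticFunction.mul_apply,
    Nat.sum_divisorsAntidiagonal (f := fun a b => Lg a * X b)]
  refine Finset.sum_congr rfl fun d hd => ?_
  have hd0 : d ≠ 0 := (Nat.pos_of_mem_divisors hd).ne'
  have hld : l / d ≠ 0 := Nat.div_ne_zero_iff_of_dvd (Nat.dvd_of_mem_divisors hd) |>.mpr ⟨hl, hd0⟩
  simp [hLg, hX, toArithmeticFunction, hd0, hld, mul_comm]

/-- `‖Σ_{d∣l} χ(l/d)·log d‖ ≤ τ₂(l)·log l`. [cite: Zhang2022LandauSiegel, §17 u025 p.98] -/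
theorem norm_sum_divisors_chi_mul_log_le (l : ℕ) :
    ‖∑ d ∈ l.divisors, χ ((l / d : ℕ) : ZMod D) * (Real.log d : ℂ)‖ ≤ tau 2 l * Real.log l := by
  rw [MeanSquareMajorant.tau_two_apply]
  refine (norm_sum_le _ _).trans ?_
  have hb : ∀ d ∈ l.divisors, ‖χ ((l / d : ℕ) : ZMod D) * (Real.log d : ℂ)‖ ≤ Real.log l := by
    intro d hd
    have hd0 : 0 < d := Nat.pos_of_mem_divisors hd
    have hdl : d ≤ l := Nat.divisor_le hd
    rw [norm_mul, Complex.norm_real, Real.norm_eq_abs, abs_of_nonneg (Real.log_natCast_nonneg d)]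
    calc ‖χ ((l / d : ℕ) : ZMod D)‖ * Real.log d ≤ 1 * Real.log d :=
          mul_le_mul_of_nonneg_right (DirichletCharacter.norm_le_one χ _) (Real.log_natCast_nonneg d)
      _ ≤ Real.log l := by
          rw [one_mul]; exact Real.log_le_log (by exact_mod_cast hd0) (by exact_mod_cast hdl)
  calc ∑ d ∈ l.divisors, ‖χ ((l / d : ℕ) : ZMod D) * (Real.log d : ℂ)‖
      ≤ ∑ d ∈ l.divisors, Real.log l := Finset.sum_le_sum hb
    _ = (l.divisors.card : ℝ) * Real.log l := by rw [Finset.sum_const, nsmul_eq_mul]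

/-- `‖μ(k)‖ ≤ 1`. [folklore] -/
private theorem norm_moebius_cast_le_one' (k : ℕ) : ‖(ArithmeticFunction.moebius k : ℂ)‖ ≤ 1 := by
  rw [Complex.norm_intCast]
  exact_mod_cast ArithmeticFunction.abs_moebius_le_one

/-- `‖(χ∗μ)(a)‖ ≤ τ₂(a)` (both vanish at `a = 0`). [cite: Zhang2022LandauSiegel, §3 (3.1) p.12] -/
theorem norm_chi_conv_moebius_le (a : ℕ) :
    ‖LSeries.convolution (fun k => χ (k : ZMod D)) (fun k => (ArithmeticFunction.moebius k : ℂ)) a‖ ≤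
      tau 2 a := by
  have h := norm_convolution_le_tau_add (u := fun k => χ (k : ZMod D))
    (v := fun k => (ArithmeticFunction.moebius k : ℂ)) (C₁ := 1) (C₂ := 1) (j₁ := 1) (j₂ := 1)
    zero_le_one
    (fun n hn => by rw [MeanSquareMajorant.tau_one_apply hn, mul_one]; exact DirichletCharacter.norm_le_one χ _)
    (fun n hn => by
      rw [MeanSquareMajorant.tau_one_apply hn, mul_one]
      exact norm_moebius_cast_le_one' n) a
  simpa using h

end Defect

end Literature.NumberTheory.LFunctions.Zhang2022.Typed.Section17
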